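import Summits.BirchSwinnertonDyer.BirchSwinnertonDyer.Theorems.EisensteinDepletionAtTwoStarDoorThreePrints
import Summits.BirchSwinnertonDyer.BirchSwinnertonDyer.Theorems.EisensteinDepletionAtTwoStarE1MTwoPrints
import HarnessLib

/-!
# The banked aside E1 `DepletedLambdaLawAtTwo` (stmt-BirchSwinnertonDyer-20237) in the currency of line `star` v16 (lead star-p1 GEN 20)

E1 is E1M (stmt-BirchSwinnertonDyer-20341) with its modularity antecedent discharged; modularity is the tree's NAMED FACT `exists_isNewformOf`
(Wiles 1995 / Taylor–Wiles 1995 / Breuil–Conrad–Diamond–Taylor 2001; statement only).  With GEN 20's end-state door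
`SigmaNode.depletedLambdaLawAtTwoMod_of_threePrints` this records, BY NAME, the status of the stronger aside:

* `depletedLambdaLawAtTwo_of_modularity_threePrints : exists_isNewformOf → (F) → Abbes–Ullmo → UBD → DepletedLambdaLawAtTwo`.

So the four statements of this family read, modulo named published facts only: E1 (20237) ⇐ {modularity, (F), A–U, UBD}; E1M (20341) and E1M_NSF (27021)
⇐ their own modularity binder + {(F), A–U, UBD} (Theorems/…StarDoorThreePrints, …StarNsfDoorThreePrints); `StarOptB` (24445) / `StarOptBNSF` (27047)
⇐ {(F), UBD}.  HONEST FRAMING (Barrier B1): CONDITIONAL; none of these items, nor the leaf T-r3₂, nor BSD is proved (PARTITION D-0054: none — r_an ≥ 2,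
axis S0; no S0 motion).  No `sorry`, no definition.
-/

set_option linter.dupNamespace false
set_option autoImplicit false

noncomputable section

open Literature.NumberTheory.EllipticCurves Literature.NumberTheory.EllipticCurves.ModularForms

namespace Summit.BirchSwinnertonDyer.BirchSwinnertonDyer.Theorems.DepletionAtTwo.SigmaNode

/-- **E1 `DepletedLambdaLawAtTwo` (aside item 20237) from FOUR named published facts, BY NAME**: modularity `exists_isNewformOf` feeds the antecedent of
E1M, and `depletedLambdaLawAtTwoMod_of_threePrints` does the rest.  CONDITIONAL on the four facts; 20237 NOT closed.
[cite: BreuilConradDiamondTaylor2001, Thm. A] [cite: GreenbergVatsal2000, §3 Thm. (3.12), display (28)] [cite: ConradEdixhovenStein2003, §6.1.2 proof of Lemma 6.1.6 (p. 381)]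
[cite: AbbesUllmo1996, Thm. A] [cite: CalegariDimitrovTang2025, Thm. 1.0.1] -/
theorem depletedLambdaLawAtTwo_of_modularity_threePrints (hmod : exists_isNewformOf)
    (hF : gamma1Parametrization_cuspImage_nonsingularReduction) (hAU : abbesUllmo_not_dvd_maninConstant_of_not_dvd_level)
    (hU : Literature.NumberTheory.Automorphic.CalegariDimitrovTang2025_unboundedDenominators) :
    Summit.BirchSwinnertonDyer.BirchSwinnertonDyer.Theses.EisensteinDepletionAtTwo.DepletedLambdaLawAtTwo :=
  depletedLambdaLawAtTwoMod_of_threePrints hF hAU hU hmod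

/-- **E1 `DepletedLambdaLawAtTwo` (aside item 20237) from THREE named published facts, BY NAME** (appended, lead star-p1 GEN 22; the
currency of line `star` v19, GEN 21): modularity `exists_isNewformOf` feeds the antecedent of E1M and GEN 21's end-state door
`EvenBranch.depletedLambdaLawAtTwoMod_of_cuspNonsingular_ubd : (F) → UBD → E1M` does the rest — Abbes–Ullmo Thm A is NO LONGER an input
(the parity split, Theorems/…StarEvenKummerForm, …StarEtaleLiftSecondPoint, …StarDoubleLiftFalse).  So, modulo named published facts
only: E1 (20237) ⇐ {modularity, (F), UBD}; E1M (20341) / E1M_NSF (27021) ⇐ their own modularity binder + {(F), UBD}.  CONDITIONAL on the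
three facts; 20237 NOT closed; the leaf T-r3₂ and BSD are NOT proved (PARTITION D-0054: none — r_an ≥ 2, axis S0; no S0 motion).
[cite: BreuilConradDiamondTaylor2001, Thm. A] [cite: GreenbergVatsal2000, §3 Thm. (3.12), display (28)]
[cite: ConradEdixhovenStein2003, §6.1.2 proof of Lemma 6.1.6 (p. 381)] [cite: CalegariDimitrovTang2025, Thm. 1.0.1] -/
theorem depletedLambdaLawAtTwo_of_modularity_twoPrints (hmod : exists_isNewformOf)
    (hF : gamma1Parametrization_cuspImage_nonsingularReduction)
    (hU : Literature.NumberTheory.Automorphic.CalegariDimitrovTang2025_unboundedDenominators) :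
    Summit.BirchSwinnertonDyer.BirchSwinnertonDyer.Theses.EisensteinDepletionAtTwo.DepletedLambdaLawAtTwo :=
  EvenBranch.depletedLambdaLawAtTwoMod_of_cuspNonsingular_ubd hF hU hmod

end Summit.BirchSwinnertonDyer.BirchSwinnertonDyer.Theorems.DepletionAtTwo.SigmaNode

end
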